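import Summits.CriticalPhenomena.SAWScalingLimit.Theses.SAWRenewalTightness
import Literature.Probability.LatticeModels.MeshDomainBigComponents
import Literature.Probability.LatticeModels.MeshDomainJordan
import Literature.Probability.LatticeModels.MeshDomainBulk
import Literature.Probability.LatticeModels.MeshSocketedDisc
import Summits.CriticalPhenomena.SAWScalingLimit.Theorems.IsingBoundaryRatio.Negative.IsingBoundaryRatioNesting

/-!
# `ShellCrossingBound`, line `socket-comparison`, stub S2 `stub_socketNesting`: socket nesting

Crux item `stmt-CriticalPhenomena-4728` (`SAWRenewalTightness.ShellCrossingBound`), registered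
stub `stub_socketNesting` (`SocketNesting` of the line skeleton, with `IsSocket`, `Nested`,
`socketDomain` unfolded).  For a Dobrushin domain `D = (D'; a, b)` with admissible socket
parameters `L, r` (`D̄' ⊆ B(0, L/2)`, `0 < r`, `8r ≤ |a - b|`) let
`Ω := D' ∪ (B(0, L) ∖ (B̄(a, r) ∪ B̄(b, r)))` be the SOCKETED DISC.  Then for all small meshes
`δ` every self-avoiding walk of the discrete domain `D'_δ` (mesh graph on the largest mesh
component `meshDomain D' δ`) from `a_δ` to `b_δ` is, with the same support, a self-avoiding walk
of `Ω_δ`.  This is the hypothesis of the exact restriction covariance of the critical SAW law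
(`restrictionCovariance_holds` of the skeleton), by which arm estimates in `Ω` transfer to `D'`.

## Proof

* Reduction (`exists_domainSAW_of_meshDomain_subset`): since `D' ⊆ Ω`, mesh vertices and mesh
  edges of `D'` are mesh vertices and edges of `Ω` (`[δx, δy] ⊆ D̄' ⊆ Ω̄`), so a walk of `D'_δ`
  transfers edge by edge to `Ω_δ` (`SimpleGraph.Walk.transfer`) as soon as
  `meshDomain D' δ ⊆ meshDomain Ω δ`; the endpoint approximation is not even needed.
* `meshDomain D' δ ⊆ meshDomain Ω δ` for small `δ` (`exists_meshDomain_subset_socket`): by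
  `JordanDomain.exists_forall_mem_meshDomain_and_reachable` (every Jordan domain), for small `δ`
  the discrete domain `D'_δ` is ONE mesh component containing the lattice points of a small
  closed disc `K ⊆ D'` about a point `z₀ ∈ D'` at distance `> 2r` from both marked points (such a
  point exists because `D'` is connected and both marked points lie on `∂D'`, `8r ≤ |a - b|`);
  so every vertex of `D'_δ` is joined inside `D'`, hence inside `Ω`, to the lattice point `k₀`
  nearest to `z₀`, and it remains to see `k₀ ∈ meshDomain Ω δ` (`meshDomain` is a union of mesh
  components, `mem_meshDomain_of_reachable_meshVertexGraph`).
* The bulk of the socketed disc is its largest mesh component (`mem_meshDomain_of_socket`).  In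
  the rigid frame `φ z = ū (z - a)`, `u = (b - a)/|b - a|` (so `φ a = 0`, `φ b = d = |a - b|`),
  with margin `m = r + ε`, the five CONVEX pieces of the disc `B(0, L - ε)` cut out by
  `im φ > m`, `re φ < -m`, `im φ < -m`, `re φ > d + m`, `m < re φ < d - m` overlap consecutively,
  so their union `V` is preconnected (`exists_socketBulk`); every `ε`-ball about `V` lies
  in `B(0, L) ∖ plugs ⊆ Ω`, so all lattice points of `V` lie in ONE mesh component `B`
  (`meshVertexGraph_reachable_of_mem_bulk`, `3δ ≤ ε`).  A point of `B(0, L - ε)` at distance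
  `> 3m/2` from both socket centres lies in `V` (`socketFar_of_lt_dist`), so any other component
  lives on the lattice points of the annulus `L - ε ≤ |z| < L` and of the two discs
  `B̄(a, 3m/2)`, `B̄(b, 3m/2)`, counted from above by disjoint `δ/2`-discs
  (`ncard_annulus_mul_sq_le`, `ncard_closedBall_mul_sq_le`), while `B` contains all lattice
  points of `B(0, L - ε)` off the two small discs, counted from below by covering `δ`-discs
  (`sq_sub_le_ncard_mul_sq`; counting and socket geometry: `MeshSocketedDisc.lean`).  With
  `r < L/8` (as `8r ≤ |a - b| < L`), `ε ≤ L/1000`, `3δ ≤ ε`: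
  `4[(L + δ/2)² - (L - ε - δ/2)²] + 16(3m/2 + δ/2)² < 0.6 L² < (L - ε - δ)²`, so `B` strictly
  outnumbers every other component and is contained in `meshDomain Ω δ`.

Folklore lattice geometry; no source treats mesh components of socketed discs.  Mathlib anchors:
`SimpleGraph.Walk.transfer`, `SimpleGraph.ConnectedComponent.supp`, `Set.ncard`,
`Convex.isPreconnected`, `IsPreconnected.union`, `IsPreconnected.subset_or_subset`,
`MeasureTheory.Measure.addHaar_real_closedBall`, `MeasureTheory.measureReal_sdiff`.  H21 anchors:
`JordanDomain.exists_forall_mem_meshDomain_and_reachable` (`MeshDomainJordan.lean`),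
`mem_meshDomain_of_reachable_meshVertexGraph` (`MeshDomainBigComponents.lean`),
`meshVertexGraph_reachable_of_mem_bulk`, `le_dist_meshPoint_of_ne` (`MeshDomainBulk.lean`).
-/

noncomputable section
open Set Metric MeasureTheory Filter Topology
open scoped unitInterval ENNReal
open Literature.Probability.RandomPlanarGeometry Literature.Probability.LatticeModels
open Summit.CriticalPhenomena.SAWScalingLimit.Theorems.IsingBoundaryRatio.Negative
  (meshGraph_mono meshVertices_mono meshVertexHom)
namespace Summit.CriticalPhenomena.SAWScalingLimit.Theorems

/-! ### Graph nesting from nesting of the discrete domains -/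

/-- Reachability in the mesh graph on mesh vertices is monotone in the domain (the mesh
vertices and the mesh graph are, `IsingBoundaryRatioNesting.lean`). [folklore] -/
theorem reachable_meshVertexGraph_mono {Ω' Ω : Set ℂ} (h : Ω' ⊆ Ω) {δ : ℝ} {x y : Site 2}
    {hx : x ∈ meshVertices Ω' δ} {hy : y ∈ meshVertices Ω' δ}
    (hr : (meshVertexGraph Ω' δ).Reachable ⟨x, hx⟩ ⟨y, hy⟩) :
    (meshVertexGraph Ω δ).Reachable ⟨x, meshVertices_mono h δ hx⟩
      ⟨y, meshVertices_mono h δ hy⟩ :=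
  hr.map (meshVertexHom h δ)

/-- **Graph nesting from nesting of the discrete domains.** If `Ω' ⊆ Ω` and
`meshDomain Ω' δ ⊆ meshDomain Ω δ`, every self-avoiding walk of `Ω'_δ` is, with the same
support, a self-avoiding walk of `Ω_δ`. [folklore] -/
theorem exists_domainSAW_of_meshDomain_subset {Ω' Ω : Set ℂ} (h : Ω' ⊆ Ω) {δ : ℝ}
    (hD : meshDomain Ω' δ ⊆ meshDomain Ω δ) {u v : Site 2} (γ' : SAW.DomainSAW Ω' δ u v) :
    ∃ γ : SAW.DomainSAW Ω δ u v, γ.walk.support = γ'.walk.support := by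
  have hE : ∀ e, e ∈ γ'.walk.edges → e ∈ (discreteDomainGraph Ω δ).edgeSet := by
    intro e he
    induction e using Sym2.ind with
    | h x y =>
      rw [SimpleGraph.mem_edgeSet]
      obtain ⟨hadj, hxD, hyD⟩ := discreteDomainGraph_adj_iff.1 (γ'.walk.adj_of_mem_edges he)
      exact discreteDomainGraph_adj_iff.2 ⟨meshGraph_mono h δ hadj, hD hxD, hD hyD⟩
  exact ⟨⟨γ'.walk.transfer _ hE, γ'.isPath.transfer hE⟩, γ'.walk.support_transfer hE⟩

/-- A mesh vertex whose component is at least as large as every component lies in `Ω_δ`.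
[folklore] -/
theorem mem_meshDomain_of_forall_ncard_le {Ω : Set ℂ} {δ : ℝ} (x : meshVertices Ω δ)
    (h : ∀ C : (meshVertexGraph Ω δ).ConnectedComponent,
      C.supp.ncard ≤ ((meshVertexGraph Ω δ).connectedComponentMk x).supp.ncard) :
    (x : Site 2) ∈ meshDomain Ω δ := by
  simp only [meshDomain, mem_iUnion, mem_image]
  exact ⟨_, h, x, rfl, rfl⟩


/-! ### The bulk is the largest mesh component of the socketed disc -/

/-- **The bulk of the socketed disc lies in its discrete domain.** Let `Ω` be squeezed between
the disc `B(0, L)` minus the two closed socket balls `B̄(p₀, r)`, `B̄(p₁, r)` and the disc itself,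
with `|p₀|, |p₁| < L/2`, `0 < r`, `8r ≤ |p₀ - p₁|`, and let `0 < ε ≤ min (L/1000, r/4)`,
`0 < 3δ ≤ ε`.  Then every lattice point of `δℤ²` in `B(0, L - ε)` at distance `> 3(r + ε)/2`
from both socket centres lies in `meshDomain Ω δ`: its mesh component (the bulk) strictly
outnumbers every other component.  See the module docstring. [folklore] -/
theorem mem_meshDomain_of_socket {Ω : Set ℂ} {p₀ p₁ : ℂ} {L r ε δ : ℝ}
    (hΩL : Ω ⊆ ball 0 L) (hΩ : ball 0 L \ (closedBall p₀ r ∪ closedBall p₁ r) ⊆ Ω)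
    (hp₀ : ‖p₀‖ < L / 2) (hp₁ : ‖p₁‖ < L / 2) (hr : 0 < r) (hd : 8 * r ≤ dist p₀ p₁)
    (hε : 0 < ε) (hεL : 1000 * ε ≤ L) (hεr : 4 * ε ≤ r) (hδ : 0 < δ) (hδε : 3 * δ ≤ ε)
    {x : Site 2} (hxL : ‖meshPoint δ x‖ < L - ε)
    (hx₀ : 3 * (r + ε) / 2 < dist (meshPoint δ x) p₀)
    (hx₁ : 3 * (r + ε) / 2 < dist (meshPoint δ x) p₁) :
    x ∈ meshDomain Ω δ := by
  classical
  -- the socketFrame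
  set d : ℝ := dist p₀ p₁ with hd_def
  have hd0 : 0 < d := by linarith
  have hdL : d < L :=
    calc d = ‖p₀ - p₁‖ := dist_eq_norm _ _
      _ ≤ ‖p₀‖ + ‖p₁‖ := norm_sub_le _ _
      _ < L := by linarith
  set u : ℂ := (p₁ - p₀) * ((d⁻¹ : ℝ) : ℂ) with hu_def
  have hu : ‖u‖ = 1 := by
    rw [hu_def, norm_mul, Complex.norm_real, Real.norm_eq_abs, abs_inv, abs_of_pos hd0,
      ← dist_eq_norm, dist_comm, ← hd_def, mul_inv_cancel₀ hd0.ne']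
  have hp₁' : p₀ + u * d = p₁ := by
    rw [hu_def, mul_assoc, ← Complex.ofReal_mul, inv_mul_cancel₀ hd0.ne']
    push_cast
    ring
  set m : ℝ := r + ε with hm_def
  set M : ℝ := L - ε with hM_def
  -- the bulk `V` of the socketed disc (preconnected union of five convex pieces)
  obtain ⟨V, hVc, hVM, htriV, hfarV⟩ := exists_socketBulk (p₀ := p₀) (d := d) (m := m) (M := M)
    hu (by positivity) (by rw [hm_def]; linarith) (by rw [hM_def, hm_def]; linarith)
    (by rw [hp₁', hM_def, hm_def]; linarith)
  -- a point of the disc `B(0, M)` off the two `3m/2`-discs is in `V`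
  have htri : ∀ z : ℂ, ‖z‖ < M → 3 * m / 2 < dist z p₀ → 3 * m / 2 < dist z p₁ → z ∈ V := by
    intro z hzM hz0 hz1
    refine htriV z hzM ?_ ?_
    · rwa [← dist_eq_norm]
    · rwa [hp₁', ← dist_eq_norm]
  have hxV : meshPoint δ x ∈ V := htri _ hxL hx₀ hx₁
  -- `ε`-balls about `V` lie inside `Ω`
  have hVΩ : ∀ w ∈ V, ball w ε ⊆ Ω := by
    intro w hw z hz
    have hzw : ‖z - w‖ < ε := by rw [← dist_eq_norm]; exact mem_ball.1 hz
    obtain ⟨h0, h1⟩ := hfarV w hw z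
    rw [hp₁'] at h1
    have hwM : ‖w‖ < L - ε := mem_ball_zero_iff.1 (hVM hw)
    refine hΩ ⟨?_, ?_⟩
    · rw [mem_ball_zero_iff]
      calc ‖z‖ ≤ ‖z - w‖ + ‖w‖ := norm_le_norm_sub_add _ _
        _ < ε + (L - ε) := add_lt_add hzw hwM
        _ = L := by ring
    · rintro (hz0 | hz1)
      · rw [mem_closedBall, dist_eq_norm] at hz0; linarith
      · rw [mem_closedBall, dist_eq_norm] at hz1; linarith
  -- hence all lattice points of `V` are in the mesh component `B` of `x`
  set G := meshVertexGraph Ω δ with hG_def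
  have hxΩ : x ∈ meshVertices Ω δ := hVΩ _ hxV (mem_ball_self hε)
  set B : G.ConnectedComponent := G.connectedComponentMk ⟨x, hxΩ⟩ with hB_def
  have hVB : ∀ y : Site 2, meshPoint δ y ∈ V →
      ∃ hy : y ∈ meshVertices Ω δ, G.connectedComponentMk ⟨y, hy⟩ = B := by
    intro y hy
    obtain ⟨hy', _, hreach⟩ := meshVertexGraph_reachable_of_mem_bulk hδ hδε hVc hVΩ hy hxV
    exact ⟨hy', SimpleGraph.ConnectedComponent.sound hreach⟩
  -- the exceptional sites (annulus and the two small discs) and the sites of the disc `B(0, M)`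
  set A : Set (Site 2) := {y | meshPoint δ y ∈ ball (0 : ℂ) L ∧ M ≤ ‖meshPoint δ y‖} with hA_def
  set B₀ : Set (Site 2) := {y | meshPoint δ y ∈ closedBall p₀ (3 * m / 2)} with hB₀_def
  set B₁ : Set (Site 2) := {y | meshPoint δ y ∈ closedBall p₁ (3 * m / 2)} with hB₁_def
  set Dk : Set (Site 2) := {y | meshPoint δ y ∈ ball (0 : ℂ) M} with hDk_def
  have htri' : ∀ y : Site 2, ‖meshPoint δ y‖ < M → y ∉ B₀ → y ∉ B₁ →
      ∃ hy : y ∈ meshVertices Ω δ, G.connectedComponentMk ⟨y, hy⟩ = B := fun y hyM hy0 hy1 =>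
    hVB y (htri _ hyM (not_le.1 fun h => hy0 (mem_closedBall.2 h))
      (not_le.1 fun h => hy1 (mem_closedBall.2 h)))
  have hfinA : A.Finite :=
    (meshVertices_finite (Ω := ball (0 : ℂ) L) isBounded_ball hδ).subset fun y hy => hy.1
  have hfinB₀ : B₀.Finite :=
    meshVertices_finite (Ω := closedBall p₀ (3 * m / 2)) isBounded_closedBall hδ
  have hfinB₁ : B₁.Finite :=
    meshVertices_finite (Ω := closedBall p₁ (3 * m / 2)) isBounded_closedBall hδ
  have hfinB : (Subtype.val '' B.supp).Finite :=
    (meshVertices_finite (isBounded_ball.subset hΩL) hδ).subset (by rintro _ ⟨y, -, rfl⟩; exact y.2)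
  -- the counts
  have hN0 : (M - δ) ^ 2 ≤ (Dk.ncard : ℝ) * δ ^ 2 :=
    sq_sub_le_ncard_mul_sq hδ (by rw [hM_def]; linarith) 0
  have hNA : (A.ncard : ℝ) * (δ / 2) ^ 2 ≤ (L + δ / 2) ^ 2 - (M - δ / 2) ^ 2 :=
    ncard_annulus_mul_sq_le hδ (by rw [hM_def]; linarith) (by rw [hM_def]; linarith)
  have hNB₀ : (B₀.ncard : ℝ) * (δ / 2) ^ 2 ≤ (3 * m / 2 + δ / 2) ^ 2 :=
    ncard_closedBall_mul_sq_le hδ (by positivity) p₀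
  have hNB₁ : (B₁.ncard : ℝ) * (δ / 2) ^ 2 ≤ (3 * m / 2 + δ / 2) ^ 2 :=
    ncard_closedBall_mul_sq_le hδ (by positivity) p₁
  have hlt : A.ncard + 2 * B₀.ncard + 2 * B₁.ncard < Dk.ncard := by
    have hL : 0 < L := by linarith
    have hX : 3 * m / 2 + δ / 2 ≤ 0.19 * L := by rw [hm_def]; linarith
    have hX2 : (3 * m / 2 + δ / 2) ^ 2 ≤ (0.19 * L) ^ 2 := by gcongr
    have hY : 0.998 * L ≤ M - δ := by rw [hM_def]; linarith
    have hY2 : (0.998 * L) ^ 2 ≤ (M - δ) ^ 2 := by gcongr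
    have hT : (L + δ / 2) ^ 2 - (M - δ / 2) ^ 2 ≤ 0.003 * L ^ 2 := by
      have h1 : (L + δ / 2) ^ 2 - (M - δ / 2) ^ 2 = (ε + δ) * (2 * L - ε) := by
        rw [hM_def]; ring
      have h2 : ε + δ ≤ 0.0015 * L := by linarith
      have h3 : 2 * L - ε ≤ 2 * L := by linarith
      rw [h1]
      calc (ε + δ) * (2 * L - ε) ≤ (0.0015 * L) * (2 * L) :=
            mul_le_mul h2 h3 (by linarith) (by positivity)
        _ = 0.003 * L ^ 2 := by ring
    have key : ((A.ncard : ℝ) + 2 * B₀.ncard + 2 * B₁.ncard) * δ ^ 2 < (Dk.ncard : ℝ) * δ ^ 2 := by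
      nlinarith
    have := lt_of_mul_lt_mul_right key (by positivity)
    exact_mod_cast this
  -- every component is at most as large as `B`
  have hmax : ∀ C : G.ConnectedComponent, C.supp.ncard ≤ B.supp.ncard := by
    intro C
    by_cases hCB : C = B
    · rw [hCB]
    rw [← ncard_image_of_injective C.supp Subtype.val_injective,
      ← ncard_image_of_injective B.supp Subtype.val_injective]
    -- the sites of `C` are exceptional
    have hCsub : Subtype.val '' C.supp ⊆ A ∪ B₀ ∪ B₁ := by
      rintro _ ⟨⟨y, hyΩ⟩, hyC, rfl⟩
      by_contra hy
      simp only [mem_union, not_or] at hy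
      obtain ⟨⟨hyA, hy0⟩, hy1⟩ := hy
      have hyL : meshPoint δ y ∈ ball (0 : ℂ) L := hΩL hyΩ
      have hyM : ‖meshPoint δ y‖ < M := by
        by_contra hle
        exact hyA ⟨hyL, not_lt.1 hle⟩
      obtain ⟨hy', hyB⟩ := htri' y hyM hy0 hy1
      rw [SimpleGraph.ConnectedComponent.mem_supp_iff] at hyC
      exact hCB (hyC.symm.trans hyB)
    -- the sites of the disc `B(0, M)` are in `B` or in the two small discs
    have hDsub : Dk ⊆ Subtype.val '' B.supp ∪ B₀ ∪ B₁ := by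
      intro y hy
      by_contra hy'
      simp only [mem_union, not_or] at hy'
      obtain ⟨⟨hyB, hy0⟩, hy1⟩ := hy'
      obtain ⟨hy'', hyB'⟩ := htri' y (mem_ball_zero_iff.1 hy) hy0 hy1
      exact hyB ⟨⟨y, hy''⟩, (SimpleGraph.ConnectedComponent.mem_supp_iff _ _).2 hyB', rfl⟩
    have h1 : (Subtype.val '' C.supp).ncard ≤ A.ncard + B₀.ncard + B₁.ncard :=
      (ncard_le_ncard hCsub ((hfinA.union hfinB₀).union hfinB₁)).trans
        ((ncard_union_le _ _).trans (by gcongr; exact ncard_union_le _ _))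
    have h2 : Dk.ncard ≤ (Subtype.val '' B.supp).ncard + B₀.ncard + B₁.ncard :=
      (ncard_le_ncard hDsub ((hfinB.union hfinB₀).union hfinB₁)).trans
        ((ncard_union_le _ _).trans (by gcongr; exact ncard_union_le _ _))
    omega
  exact mem_meshDomain_of_forall_ncard_le ⟨x, hxΩ⟩ hmax

/-! ### Nesting of the discrete domains of a Dobrushin domain and of its socketed disc -/

/-- A Dobrushin domain sticks out of both socket balls: it has a point at distance `> 2r` from
both marked points when `8r ≤ |a - b|` (it is connected and open with `a, b ∈ ∂D'`, so it cannot
lie in the two disjoint discs `B(a, 3r) ∪ B(b, 3r)`). [folklore] -/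
theorem exists_mem_lt_dist_pt (D : DobrushinDomain) {r : ℝ} (hr : 0 < r)
    (hd : 8 * r ≤ dist (D.pt 0) (D.pt 1)) :
    ∃ z ∈ D.carrier, 2 * r < dist z (D.pt 0) ∧ 2 * r < dist z (D.pt 1) := by
  by_contra! h
  have hsub : D.carrier ⊆ ball (D.pt 0) (3 * r) ∪ ball (D.pt 1) (3 * r) := by
    intro z hz
    by_cases h0 : 2 * r < dist z (D.pt 0)
    · exact Or.inr (mem_ball.2 (by linarith [h z hz h0]))
    · exact Or.inl (mem_ball.2 (by linarith))
  have hdisj : Disjoint (ball (D.pt 0) (3 * r)) (ball (D.pt 1) (3 * r)) :=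
    ball_disjoint_ball (by linarith)
  rcases D.isConnected.isPreconnected.subset_or_subset isOpen_ball isOpen_ball hdisj hsub
    with h' | h'
  · have : D.pt 1 ∈ closedBall (D.pt 0) (3 * r) := closure_ball_subset_closedBall
      (closure_mono h' (frontier_subset_closure (D.pt_mem_frontier 1)))
    rw [mem_closedBall, dist_comm] at this
    linarith
  · have : D.pt 0 ∈ closedBall (D.pt 1) (3 * r) := closure_ball_subset_closedBall
      (closure_mono h' (frontier_subset_closure (D.pt_mem_frontier 0)))
    rw [mem_closedBall] at this
    linarith

/-- **Nesting of the discrete domains.** For a Dobrushin domain `D = (D'; a, b)` with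
`D̄' ⊆ B(0, L/2)`, `0 < r`, `8r ≤ |a - b|`, for all small meshes `δ` the discrete domain
`meshDomain D' δ` is contained in the discrete domain of the socketed disc
`D' ∪ (B(0, L) ∖ (B̄(a, r) ∪ B̄(b, r)))`.  See the module docstring. [folklore] -/
theorem exists_meshDomain_subset_socket (D : DobrushinDomain) {L r : ℝ}
    (hL : closure D.carrier ⊆ ball (0 : ℂ) (L / 2)) (hr : 0 < r)
    (hd : 8 * r ≤ dist (D.pt 0) (D.pt 1)) :
    ∃ δ₁ : ℝ, 0 < δ₁ ∧ ∀ δ : ℝ, 0 < δ → δ ≤ δ₁ → meshDomain D.carrier δ ⊆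
      meshDomain (D.carrier ∪ (ball (0 : ℂ) L \
        (closedBall (D.pt 0) r ∪ closedBall (D.pt 1) r))) δ := by
  set Ω : Set ℂ := D.carrier ∪ (ball (0 : ℂ) L \ (closedBall (D.pt 0) r ∪ closedBall (D.pt 1) r))
    with hΩ_def
  have hDL : D.carrier ⊆ ball 0 (L / 2) := subset_closure.trans hL
  have hp₀ : ‖D.pt 0‖ < L / 2 :=
    mem_ball_zero_iff.1 (hL (frontier_subset_closure (D.pt_mem_frontier 0)))
  have hp₁ : ‖D.pt 1‖ < L / 2 :=
    mem_ball_zero_iff.1 (hL (frontier_subset_closure (D.pt_mem_frontier 1)))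
  have hL0 : 0 < L := by linarith [norm_nonneg (D.pt 0)]
  have hdL : dist (D.pt 0) (D.pt 1) < L :=
    calc dist (D.pt 0) (D.pt 1) = ‖D.pt 0 - D.pt 1‖ := dist_eq_norm _ _
      _ ≤ ‖D.pt 0‖ + ‖D.pt 1‖ := norm_sub_le _ _
      _ < L := by linarith
  have hΩL : Ω ⊆ ball 0 L :=
    union_subset (hDL.trans (ball_subset_ball (by linarith))) sdiff_subset
  have hΩ' : ball (0 : ℂ) L \ (closedBall (D.pt 0) r ∪ closedBall (D.pt 1) r) ⊆ Ω :=
    subset_union_right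
  -- the base point and the compact disc about it
  obtain ⟨z₀, hz₀D, hz₀0, hz₀1⟩ := exists_mem_lt_dist_pt D hr hd
  obtain ⟨ρ, hρ, hρD⟩ := Metric.isOpen_iff.1 D.isOpen z₀ hz₀D
  have hKD : closedBall z₀ (ρ / 2) ⊆ D.carrier := (closedBall_subset_ball (by linarith)).trans hρD
  obtain ⟨δJ, hδJ, hJ⟩ :=
    D.toJordanDomain.exists_forall_mem_meshDomain_and_reachable (isCompact_closedBall z₀ (ρ / 2))
      hKD
  -- the margin and the mesh threshold
  set ε : ℝ := min (L / 1000) (r / 4) with hε_def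
  have hε : 0 < ε := by positivity
  have hεL : 1000 * ε ≤ L := by have := min_le_left (L / 1000) (r / 4); linarith
  have hεr : 4 * ε ≤ r := by have := min_le_right (L / 1000) (r / 4); linarith
  refine ⟨min (ε / 3) (min (ρ / 2) (δJ / 2)), by positivity, fun δ hδ hδle x hx => ?_⟩
  have hδε : 3 * δ ≤ ε := by have := hδle.trans (min_le_left _ _); linarith
  have hδρ : δ ≤ ρ / 2 := hδle.trans ((min_le_right _ _).trans (min_le_left _ _))
  have hδJ' : δ < δJ := by
    have := hδle.trans ((min_le_right _ _).trans (min_le_right _ _)); linarith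
  -- the base lattice point is in both discrete domains
  set k₀ : Site 2 := nearestSite δ z₀ with hk₀_def
  have hk₀z : dist (meshPoint δ k₀) z₀ ≤ δ := dist_meshPoint_nearestSite_le hδ z₀
  have hk₀D : k₀ ∈ meshDomain D.carrier δ :=
    (hJ δ hδ hδJ').1 k₀ (mem_closedBall.2 (hk₀z.trans hδρ))
  have hz₀L : ‖z₀‖ < L / 2 := mem_ball_zero_iff.1 (hDL hz₀D)
  have hk₀Ω : k₀ ∈ meshDomain Ω δ := by
    refine mem_meshDomain_of_socket hΩL hΩ' hp₀ hp₁ hr hd hε hεL hεr hδ hδε ?_ ?_ ?_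
    · calc ‖meshPoint δ k₀‖ ≤ ‖meshPoint δ k₀ - z₀‖ + ‖z₀‖ := norm_le_norm_sub_add _ _
        _ ≤ δ + ‖z₀‖ := by rw [← dist_eq_norm]; gcongr
        _ < L - ε := by linarith
    · linarith [dist_triangle z₀ (meshPoint δ k₀) (D.pt 0), dist_comm z₀ (meshPoint δ k₀)]
    · linarith [dist_triangle z₀ (meshPoint δ k₀) (D.pt 1), dist_comm z₀ (meshPoint δ k₀)]
  -- every vertex of `D'_δ` is joined to it inside `D'`, hence inside `Ω`
  obtain ⟨hk₀v, hxv, hreach⟩ := (hJ δ hδ hδJ').2 k₀ hk₀D x hx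
  exact mem_meshDomain_of_reachable_meshVertexGraph hk₀Ω _ _
    (reachable_meshVertexGraph_mono (subset_union_left (t := ball (0 : ℂ) L \
      (closedBall (D.pt 0) r ∪ closedBall (D.pt 1) r))) hreach)

/-! ### The registered stub -/

/-- **S2 `stub_socketNesting` (socket nesting).** For a Dobrushin domain `D = (D'; a, b)` with an
endpoint approximation and admissible socket parameters `L, r` (`D̄' ⊆ B(0, L/2)`, `0 < r`,
`8r ≤ |a - b|`), for all small meshes `δ` every self-avoiding walk of `D'_δ` from `a_δ` to `b_δ`
is, with the same support, a self-avoiding walk of the socketed disc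
`(D' ∪ (B(0, L) ∖ (B̄(a, r) ∪ B̄(b, r))))_δ`.  (The endpoint approximation is not used: the
nesting holds for all endpoints.) [folklore] -/
theorem stub_socketNesting :
    ∀ (D : DobrushinDomain) (a b : ℝ → Site 2), SAW.IsEndpointApprox D a b →
      ∀ (L r : ℝ), closure D.carrier ⊆ Metric.ball (0 : ℂ) (L / 2) ∧ 0 < r ∧
          8 * r ≤ dist (D.pt 0) (D.pt 1) →
        ∃ δ₁ : ℝ, 0 < δ₁ ∧ ∀ δ ∈ Set.Ioc (0 : ℝ) δ₁,
          ∀ γ' : SAW.DomainSAW D.carrier δ (a δ) (b δ),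
            ∃ γ : SAW.DomainSAW (D.carrier ∪ (Metric.ball (0 : ℂ) L \
                (Metric.closedBall (D.pt 0) r ∪ Metric.closedBall (D.pt 1) r))) δ (a δ) (b δ),
              γ.walk.support = γ'.walk.support := by
  intro D a b _ L r h
  obtain ⟨hL, hr, hd⟩ := h
  obtain ⟨δ₁, hδ₁, hnest⟩ := exists_meshDomain_subset_socket D hL hr hd
  exact ⟨δ₁, hδ₁, fun δ hδ γ' =>
    exists_domainSAW_of_meshDomain_subset subset_union_left (hnest δ hδ.1 hδ.2) γ'⟩

end Summit.CriticalPhenomena.SAWScalingLimit.Theorems
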